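import Literature.Barriers.SmoothPoincare4.ExoticOpenFourSpace
import Literature.Topology.FourManifolds.SmallExoticRFourLeaf
import HarnessLib

/-!
# Barrier `OpenAnalogueBarrierFour` from the one named leaf of spc4.S11 (the Casson–Freedman end data of a non-diffeomorphic pair)

Barrier catalogue `Literature/Barriers/SmoothPoincare4/`. Companion (one theorem; no definition, no
named fact, no `sorry`) of `ExoticOpenFourSpace.lean`, whose barrier statement
`OpenAnalogueBarrierFour` (`¬ OpenSubsetUniquenessFour`: some open subset of `ℝ⁴` homeomorphic to
`ℝ⁴` is not diffeomorphic to `ℝ⁴`) is PROVED there to be EQUIVALENT to the tree's fact spc4.S11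
(`openAnalogueBarrierFour_iff_exoticR4`:
`OpenAnalogueBarrierFour ↔ exists_opens_nonempty_homeomorph_isEmpty_diffeomorph_euclideanSpace_four`,
Kirby 1989, Ch. XIV Thm. 3 in open-subset form).

Fact-decomposition record (librarian, fact-decompose, 2026-08-16; the barrier ran to the prover
budget cap as an XL fact): being equivalent to spc4.S11, the barrier is NOT an independent proof
obligation. spc4.S11 has meanwhile been decomposed (`SmallExoticRFourLeaf.lean`) into ONE named
leaf, `Literature.Topology.FourManifolds.exists_partialProductEnds_isEmpty_diffeomorph_four` (a pair of
closed simply connected smooth 4-manifolds, h-cobordant but not diffeomorphic — Donaldson — carrying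
the Casson–Freedman end data `PartialProductEnds` of Kirby's proof, pp. 98–101), the regluing bridge
being proved (`SmallExoticRFour.lean`). The theorem below records that the barrier's residual trust
base is that same single existing leaf: `OpenAnalogueBarrierFour_holds_of`. No new named fact.

## References

* [Kirby1989] R. C. Kirby, *The Topology of 4-Manifolds*, LNM 1374 (1989), Ch. XIV, Thm. 3 and its
  proof pp. 98–101.
* [DeMichelisFreedman1992] S. De Michelis, M. H. Freedman, J. Differential Geom. 35 (1992), Thm. 3.1.
* [DonaldsonIrrationality1987] S. K. Donaldson, J. Differential Geom. 26 (1987), p. 142.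
-/

noncomputable section

namespace Literature.Barriers.SmoothPoincare4

/-- **`OpenAnalogueBarrierFour` from the one named leaf of spc4.S11** (fact-decomposition glue,
canonical name): a non-diffeomorphic h-cobordant pair with the Casson–Freedman end data
(`exists_partialProductEnds_isEmpty_diffeomorph_four`) gives a small exotic `ℝ⁴`
(`exists_opens_nonempty_homeomorph_isEmpty_diffeomorph_euclideanSpace_four_holds_of`, Kirby's
regluing argument p. 101, proved), hence the barrier (`openAnalogueBarrierFour_of_exoticR4`).
[cite: Kirby1989, Ch. XIV Thm. 3 (proof pp. 98–101)] -/
theorem OpenAnalogueBarrierFour_holds_of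
    (h : Literature.Topology.FourManifolds.exists_partialProductEnds_isEmpty_diffeomorph_four) :
    OpenAnalogueBarrierFour :=
  openAnalogueBarrierFour_of_exoticR4
    (Literature.Topology.FourManifolds.exists_opens_nonempty_homeomorph_isEmpty_diffeomorph_euclideanSpace_four_holds_of h)

end Literature.Barriers.SmoothPoincare4

end
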